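import Literature.MathematicalPhysics.QuantumFieldTheory.Balaban1983to89.B5Strip145Decay

/-!
# `Balaban1983to89.B4StripSums` — the `j`-uniform multiplier sums of B4 (2.48)/(2.51) and the exponential decay (2.35) of `G_j Q_j^*`

T. Bałaban, *Regularity and decay of lattice Green's functions*, Commun. Math. Phys. **89**, 571–597 (1983)
[Balaban1983RegularityDecay] (cell paper B04 = B4), Lemma 2.4 p. 582 [PDF 12] and its proof pp. 584–586 [PDF 14–16],
formulas (2.43)–(2.51).

CITATION HEADER (lean-in-tree rule 2026-08-18).  This module is a SUPPLEMENT, not a quotation.  Printed, verbatim: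
Lemma 2.4, p. 582: *"There exist positive constants c₀, δ₀, and for α < 1, there exists a constant c₁, such that
(2.35) |(G_j(□)Q_j^*)(x,y)|, |(∂^{L^{−j}}_μ G_j(□)Q_j^*)(x,y)| ≤ c₀e^{−δ₀|x−y|} … for arbitrary non-negative integer j"*;
p. 585, (2.48): *"(G_jQ_j^*)(x,y) = (2π)^{−d}∫_{|p′|≤π}dp′ Σ_l e^{i(p′+l)·(x−y)} [a_jΣ_{l′}|u_j(p′+l′)|²/Δ^ξ(p′+l′) + 1]^{−1}
u_j(p′+l)/Δ^ξ(p′+l)"* with (2.45) *"u_j(p) = Π_μ (e^{−ip_μ} − 1)/((e^{−iξp_μ} − 1)/ξ), Δ^ξ(p) = Σ_μ |(e^{−iξp_μ} − 1)/ξ|² +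
m_j²"*, `ξ = L^{−j}`, `l_μ = 2πm_μ`; p. 586, after (2.51): *"The expression is a function of p′ and can be extended as an
analytic function to some neighbourhood of [−π,π]^d. It is more troublesome, but equally elementary, to prove that this
neighbourhood can be chosen independently of j and that the expression is bounded also in this neighbourhood. Shifting the
domain of integration in (2.49) into a complex domain in the direction of the vector x′−y, we can bound the left hand side
of (2.49) by a constant depending on α multiplied by the exponential factor e^{−δ₀|x′−y|} … The inequalities (2.35) are
proved in the same way and constants depend on d only."*  The paper does not write the `j`-uniform complex neighbourhood
(cell gap G-B4-02, CLOSED by `B4StripCauchy.uniformStrip_holds`: one zero-free strip for the regrouped denominator `E`,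
`c ≤ |E|`, for every `n = L^j`, `a ∈ [a₋,a₊]`, `m² ∈ [0,m²₊]`), nor the `j`-uniform bound of the `l`-SUM of (2.48) on that
neighbourhood (the first inequality chain of (2.51), "`Σ_l O(1) … Π_μ(1+|l_μ|)^{−1} … ≤ O(1)`", is asserted for real `p′`
from the four displayed `O(1)`-bounds of p. 585 and silently carried to complex `p′`).  THIS FILE SUPPLIES THE LATTER for the
first quantity of (2.35), `G_jQ_j^*` itself, and assembles the decay (cell journal node G-B4-02a-SUMS-KERNEL):

* §1 `w`, `v`, `ef`: ONE COORDINATE.  `v_n(j; z) = (1/n) Σ_{s<n} e^{−is(z+2πj)/n}` is the ENTIRE continuation of the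
  factor `ξ(e^{−ip_μ} − 1)/(e^{−iξp_μ} − 1)` of `u_j(p′+l)` (`v_eq_quotient`, the geometric sum; the printed quotient has
  removable singularities), `ef` the sub-lattice phase `e^{i(p′_μ+l_μ)τ_μ/n}`; `2π`-periodicity up to the residue shift
  `j ↦ j+1 (mod n)` (`v_add_two_pi`, `ef_add_two_pi`); the modulus identity `|v|² = e^{Im z(1−1/n)} |S₁(z)|/|S_ξ(z+2πj)|`
  (`norm_v_sq`; for real `z` the printed `|u|²`, `B4Strip.uFactor`) and from `B4StripCauchy.norm_uFactor_zero_le/ne_le`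
  the `n`-UNIFORM bound `|v_n(j; z)| ≤ 12/ω_n(j)`, `ω_n(j) = min(j+1, n−j)`, on the fat box `|Re z| ≤ π + r`, `|Im z| ≤ 2r`,
  `r ≤ 1/4` (`norm_v_le`) — the complex form of the printed `|u_j(p′+l)| ≤ O(1)Π_μ(1+|l_μ|)^{−1}`.
* §2 `W`, `re_DeltaXi_shift_ge_W`, `sum_omega_rpow_le`: the complex form of the printed `|Δ^ξ(p′+l)| ≥ O(1)(|p′+l|²+m²)`:
  `Re(Δ^ξ+m²)(q+2πk) ≥ (7/64) Σ_{ν: k_ν≠0} ω_n(k_ν)²` on the fat region, `k ≠ 0`; the quadratic gain is distributed over the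
  coordinates with real exponents, `1/W ≤ Π_ν ω_n(k_ν)^{−2/d}` (`inv_W_le_prod_rpow`), and `Σ_{j∈ℤ_n} ω_n(j)^{−(1+2/d)} ≤ 2ζ_d`,
  `ζ_d = Σ_{i≥1} i^{−(1+2/d)} < ∞` (`sum_omega_rpow_le`) — the printed `(Σ_{l∈Z}(1+|l_μ|)^{−1−(1−α)/d})^d ≤ O(1)` with the
  exponent `2/d` that the undifferentiated kernel affords (no `α` is needed for the first quantity of (2.35)).
* §3 `F`, `R`, `term`, `G`, `norm_G_le`: THE MULTIPLIER.  `G_{n,a,m²,τ}(p′) = Σ_{k∈{0..n−1}^d} F_k R_k/E`, `F_k = Π_ν ef·v`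
  (`= e^{i(p′+l)·ξτ} u_j(p′+l)`), `R_k = (Δ^ξ+m²)(p′)/(Δ^ξ+m²)(p′+2πk)` (`R_0 = 1`), `E` the regrouped denominator of
  `B4Strip`; `R_k/E = 1/[(Δ^ξ+m²)(p′+l)·(1 + a_jΣ_{l′}|u_j(p′+l′)|²/Δ^ξ(p′+l′))]` IS the printed denominator of (2.48)
  (`R_div_E_eq_printed`, `term_eq_printed`) — the regrouping is forced: the printed factors `1/Δ^ξ(p′+l)`, `B = E/Δ^ξ` have
  poles inside every strip when `m = 0` (`B4Strip.printed_factor_has_poles`), only their product is holomorphic there.  For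
  `x = x⁰ + ξτ ∈ ξℤ^d` (`x⁰ ∈ ℤ^d`, `τ ∈ {0..n−1}^d`) and `y ∈ ℤ^d`, since `e^{il·(x⁰−y)} = 1`, (2.48) reads
  `(G_jQ_j^*)(x,y) = (2π)^{−d}∫ G_{n,a_j,m_j²,τ}(p′) e^{ip′·(x⁰−y)} dp′ = latticeKernel G (x⁰−y)` (`B4ContourShift.latticeKernel`;
  the residues `k ∈ {0..n−1}` replace the printed symmetric `m_μ`, every summand being `n`-periodic in `m_μ`).
  `norm_G_le`: where `|E| ≥ c`, `|G| ≤ c⁻¹ C_R (48ζ_d)^d =: boundG`, INDEPENDENT of `n`, `τ`, `a`, `m² ∈ [0,m²₊]`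
  (`Σ_k Π_ν = Π_ν Σ_j`, `Finset.prod_univ_sum`).
* §4–§5: joint holomorphy of `G` on the fat region where `E ≠ 0` (`differentiableAt_G`), and the side periodicity
  `G(p′+2πe_μ) = G(p′)` at strip points with `Re p′_μ = −π` (`G_tr_side`: relabel `l ↦ l + 2πe_μ` by
  `B5Strip145Analytic.sigmaEquiv`, the shift law `E_tr` of `E`, and `Re(Δ^ξ+m²) > 0` on the strip edges,
  `re_DeltaXi_pos_of_edge` — only generic lemmas of the B5 modules are used, no B5 statement).
* §6 **`stripRegular_G`**, **`multiplier248_stripRegular (ha : 0 < a₋)`**: `∃ κ > 0, M ≥ 0` such that for EVERY `n ≥ 1`,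
  `a ∈ [a₋,a₊]`, `m² ∈ [0,m²₊]`, `τ`: `B4ContourShift.StripRegular (G n a m2 τ) κ M`; and by the generic contour-shift engine
  `B4ContourShift.latticeKernel_decay` of the surge seat pv17, **`kernel248_decay (ha : 0 < a₋)`**:
  `‖latticeKernel (G n a m2 τ) x‖ ≤ M e^{−κ|x|_∞}` for every `x ∈ ℤ^{d+1}` (`kernel248_decay_euclid`: rate `κ/√(d+1)` in
  `|x|_2`) — the first inequality of (2.35) for the free fine-lattice propagator `G_j` on `ξℤ^{d+1}`, with `c₀, δ₀`
  depending on `(d, a₋, a₊, m²₊)` only (`|x−y|` and `|x⁰−y|` differ by at most `1`, a factor `e^{κ}` in `c₀`).  ONLY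
  HYPOTHESIS: `0 < a₋` (B4's `a_j ∈ [a(1−L^{−2}), a]`, `m_j² = m²L^{−2(k−j)} ≤ m²`).  Dimension `d+1 ≥ 1` arbitrary; `n ≥ 1`
  arbitrary (not only powers of `L`).

NOT covered (stated so that no consumer over-reads this file): the second quantity `∂^{L^{−j}}_μ G_jQ_j^*` of (2.35) and the
Hölder bound (2.36)/(2.49) (multiplier factor `∂^ξ_μ(p′+l) = n(e^{i(p′_μ+l_μ)/n} − 1)`, growing in `l`, compensated by `α < 1`);
(2.37); the multiple-reflection reduction (2.42) from `G_j(□)` to `G_j`; the finite-torus kernels (Poisson periodisation of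
`latticeKernel`); the operators `G_k(Ω,Λ,A)` with boundary conditions (Cor. 2.3, cell gap G-B4-04).  Method: Fourier analysis
on `ξℤ^d` with block averaging + Cauchy estimates + contour shift, as printed (p. 586 l. 9–15); the explicit constants
(`12/ω`, `7/64`, `2/d`, `48ζ_d`) are the audit's, the paper has `O(1)`.  Value = kernel certificate of a located printed
step ("more troublesome, but equally elementary"), NOT summit progress.  Unit b2b-balaban-b04-g4 (B04 cell, gen 4); staged
byte-identically under `HOME/lean/BalabanYm4/`.
-/

namespace Literature.MathematicalPhysics.QuantumFieldTheory.Balaban1983to89.B4StripSums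

open Complex Finset
open Literature.MathematicalPhysics.QuantumFieldTheory.Balaban1983to89.B4Strip
open Literature.MathematicalPhysics.QuantumFieldTheory.Balaban1983to89.B4StripCauchy
open Literature.MathematicalPhysics.QuantumFieldTheory.Balaban1983to89.B5Strip145Analytic
open Literature.MathematicalPhysics.QuantumFieldTheory.Balaban1983to89.B5Strip145Decay
open Literature.MathematicalPhysics.QuantumFieldTheory.Balaban1983to89.B4ContourShift
open scoped Real

noncomputable section

variable {d : ℕ}

/-! ### §1 One coordinate: the block-averaging factor as an entire function, and the sub-lattice phase -/

/-- `w_n(j; z) = e^{-i (z + 2πj)/n}`. [folklore] -/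
def w (n j : ℕ) (z : ℂ) : ℂ := cexp (-(I * (z + 2 * π * j) / n))

/-- `v_n(j; z) = (1/n) Σ_{s=0}^{n-1} w_n(j; z)^s` — the ENTIRE continuation of one coordinate factor
`ξ (e^{-i p_μ} - 1)/(e^{-i ξ p_μ} - 1)`, `p = p′ + l`, `l_μ = 2πj`, `ξ = 1/n`, of `u_j(p′+l)` ((2.45) p. 584):
off the zeros of the denominator the geometric sum equals that quotient (`v_eq_quotient`). [cite: Balaban1983RegularityDecay, (2.45) p.584] -/
def v (n j : ℕ) (z : ℂ) : ℂ := (n : ℂ)⁻¹ * ∑ s ∈ Finset.range n, w n j z ^ s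

/-- the sub-lattice phase `e^{i (z + 2πj) t/n}` of one coordinate (`x_μ = x⁰_μ + t/n`, `t ∈ {0,…,n-1}`, in
`e^{i(p′+l)x}` of (2.48)). [cite: Balaban1983RegularityDecay, (2.48) p.585] -/
def ef (n j t : ℕ) (z : ℂ) : ℂ := cexp (I * (z + 2 * π * j) * t / n)

/-- `ω_n(j) = min(j+1, n-j)`: one plus the distance of the residue `j` from `0` in `ℤ/n`. [folklore] -/
def omega (n j : ℕ) : ℝ := min ((j : ℝ) + 1) ((n : ℝ) - j)

/-- `ω_n(j) > 0` for a residue `j < n`. [folklore] -/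
theorem omega_pos (n j : ℕ) (hjn : j < n) : 0 < omega n j := by
  unfold omega
  have : (j : ℝ) + 1 ≤ n := by exact_mod_cast hjn
  exact lt_min (by positivity) (by linarith)

/-- `ω_n(j) ≥ 1` for a residue `j < n`. [folklore] -/
theorem one_le_omega (n j : ℕ) (hjn : j < n) : 1 ≤ omega n j := by
  unfold omega
  have : (j : ℝ) + 1 ≤ n := by exact_mod_cast hjn
  have : (0 : ℝ) ≤ j := Nat.cast_nonneg j
  exact le_min (by linarith) (by linarith)

/-- `ω_n(0) = 1`. [folklore] -/
theorem omega_zero (n : ℕ) (hn : 1 ≤ n) : omega n 0 = 1 := by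
  unfold omega
  have : (1 : ℝ) ≤ n := by exact_mod_cast hn
  simp only [Nat.cast_zero, zero_add, sub_zero]
  exact min_eq_left this

/-- `ω_n(j) ≤ j + 1`. [folklore] -/
theorem omega_le_left (n j : ℕ) : omega n j ≤ (j : ℝ) + 1 := min_le_left _ _

/-- `ω_n(j) ≤ n − j`. [folklore] -/
theorem omega_le_right (n j : ℕ) : omega n j ≤ (n : ℝ) - j := min_le_right _ _

/-- residue arithmetic behind the `2π`-periodicity: `z + 2π + 2πj = z + 2π((j+1) mod n) + 2πn⌊(j+1)/n⌋`. [folklore] -/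
theorem shift_decomp (n j : ℕ) (z : ℂ) :
    z + 2 * π + 2 * π * (j : ℂ) =
      z + 2 * π * (((j + 1) % n : ℕ) : ℂ) + 2 * π * (n : ℂ) * (((j + 1) / n : ℕ) : ℂ) := by
  have h : (((j + 1) % n : ℕ) : ℂ) + (n : ℂ) * (((j + 1) / n : ℕ) : ℂ) = (j : ℂ) + 1 := by
    exact_mod_cast Nat.mod_add_div (j + 1) n
  linear_combination (-(2 * (π : ℂ))) * h

/-- `w` is `2π`-periodic up to the residue shift `j ↦ j+1 (mod n)`. [folklore] -/
theorem w_add_two_pi (n j : ℕ) (hn : n ≠ 0) (z : ℂ) :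
    w n j (z + 2 * π) = w n ((j + 1) % n) z := by
  unfold w
  rw [shift_decomp n j z]
  have hn' : (n : ℂ) ≠ 0 := Nat.cast_ne_zero.mpr hn
  rw [show -(I * (z + 2 * π * (((j + 1) % n : ℕ) : ℂ) + 2 * π * n * (((j + 1) / n : ℕ) : ℂ)) / n)
      = -(I * (z + 2 * π * (((j + 1) % n : ℕ) : ℂ)) / n) + -((((j + 1) / n : ℕ) : ℂ) * (2 * π * I)) by
      field_simp; ring]
  rw [Complex.exp_add, Complex.exp_neg ((((j + 1) / n : ℕ) : ℂ) * (2 * π * I)),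
    Complex.exp_nat_mul_two_pi_mul_I, inv_one, mul_one]

/-- the phase is `2π`-periodic up to the same residue shift. [folklore] -/
theorem ef_add_two_pi (n j t : ℕ) (hn : n ≠ 0) (z : ℂ) :
    ef n j t (z + 2 * π) = ef n ((j + 1) % n) t z := by
  unfold ef
  rw [shift_decomp n j z]
  have hn' : (n : ℂ) ≠ 0 := Nat.cast_ne_zero.mpr hn
  rw [show I * (z + 2 * π * (((j + 1) % n : ℕ) : ℂ) + 2 * π * n * (((j + 1) / n : ℕ) : ℂ)) * t / n
      = I * (z + 2 * π * (((j + 1) % n : ℕ) : ℂ)) * t / n + (((j + 1) / n * t : ℕ) : ℂ) * (2 * π * I) by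
      push_cast; field_simp]
  rw [Complex.exp_add, Complex.exp_nat_mul_two_pi_mul_I, mul_one]

/-- `v` is `2π`-periodic up to the residue shift. [folklore] -/
theorem v_add_two_pi (n j : ℕ) (hn : n ≠ 0) (z : ℂ) :
    v n j (z + 2 * π) = v n ((j + 1) % n) z := by
  unfold v
  simp_rw [w_add_two_pi n j hn z]

/-- `w_n(j; z)^n = e^{-iz}` (the `2πj` drops out). [folklore] -/
theorem w_pow (n j : ℕ) (hn : n ≠ 0) (z : ℂ) : w n j z ^ n = cexp (-(I * z)) := by
  unfold w
  rw [← Complex.exp_nat_mul]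
  have hn' : (n : ℂ) ≠ 0 := Nat.cast_ne_zero.mpr hn
  rw [show (n : ℂ) * (-(I * (z + 2 * π * j) / n)) = -(I * z) + -((j : ℂ) * (2 * π * I)) by
      field_simp; ring]
  rw [Complex.exp_add, Complex.exp_neg ((j : ℂ) * (2 * π * I)), Complex.exp_nat_mul_two_pi_mul_I,
    inv_one, mul_one]

/-- the dictionary with the printed factor: off the zeros of the denominator,
`v_n(j; z) = (e^{-iz} - 1) / (n (e^{-i(z+2πj)/n} - 1))`. [cite: Balaban1983RegularityDecay, (2.45) p.584] -/
theorem v_eq_quotient (n j : ℕ) (hn : n ≠ 0) {z : ℂ} (hw : w n j z ≠ 1) :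
    v n j z = (cexp (-(I * z)) - 1) / ((n : ℂ) * (w n j z - 1)) := by
  unfold v
  rw [geom_sum_eq hw, w_pow n j hn z]
  have hn' : (n : ℂ) ≠ 0 := Nat.cast_ne_zero.mpr hn
  have hw' : w n j z - 1 ≠ 0 := sub_ne_zero.mpr hw
  field_simp

/-- `|S₁(θ)| = 2 cosh(Im θ) − 2 cos(Re θ)`. [folklore] -/
theorem norm_S1_eq (θ : ℂ) : ‖S1 θ‖ = 2 * Real.cosh θ.im - 2 * Real.cos θ.re := by
  rw [S1_eq_Sxi_one, norm_Sxi_eq 1 one_ne_zero]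
  have h1 : Real.sin (θ.re / (2 * ((1 : ℕ) : ℝ))) ^ 2 = 1 / 2 - Real.cos θ.re / 2 := by
    rw [Real.sin_sq, Real.cos_sq]
    have : 2 * (θ.re / (2 * ((1 : ℕ) : ℝ))) = θ.re := by push_cast; ring
    rw [this]; ring
  have h2 : Real.sinh (θ.im / (2 * ((1 : ℕ) : ℝ))) ^ 2 = (Real.cosh θ.im - 1) / 2 := by
    have e : θ.im = 2 * (θ.im / (2 * ((1 : ℕ) : ℝ))) := by push_cast; ring
    have hc := Real.cosh_two_mul (θ.im / (2 * ((1 : ℕ) : ℝ)))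
    have hs := Real.cosh_sq (θ.im / (2 * ((1 : ℕ) : ℝ)))
    rw [← e] at hc
    linarith
  rw [h1, h2]; push_cast; ring

/-- `|e^{-iθ} − 1|² = e^{Im θ} |S₁(θ)|`. [folklore] -/
theorem norm_sq_exp_sub_one (θ : ℂ) : ‖cexp (-(I * θ)) - 1‖ ^ 2 = Real.exp θ.im * ‖S1 θ‖ := by
  have hre : (cexp (-(I * θ)) - 1).re = Real.exp θ.im * Real.cos θ.re - 1 := by
    simp [Complex.exp_re]
  have him : (cexp (-(I * θ)) - 1).im = -(Real.exp θ.im * Real.sin θ.re) := by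
    simp [Complex.exp_im]
  rw [Complex.sq_norm, Complex.normSq_apply, hre, him, norm_S1_eq, Real.cosh_eq]
  have hsc := Real.sin_sq_add_cos_sq θ.re
  have he : Real.exp θ.im * Real.exp (-θ.im) = 1 := by rw [← Real.exp_add]; simp
  linear_combination (Real.exp θ.im) ^ 2 * hsc - he

/-- `S_ξ(z) = n² S₁(z/n)`. [folklore] -/
theorem Sxi_eq_sq_mul_S1 (n : ℕ) (z : ℂ) : Sxi n z = (n : ℂ) ^ 2 * S1 (z / n) := by
  simp [Sxi, S1]

/-- where `S_ξ(z + 2πj) ≠ 0` the ratio `w` is not `1` (so the geometric sum has its closed form). [folklore] -/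
theorem w_ne_one (n j : ℕ) {z : ℂ} (hS : Sxi n (z + 2 * π * j) ≠ 0) : w n j z ≠ 1 := by
  intro h
  have h2 := norm_sq_exp_sub_one ((z + 2 * π * j) / n)
  have hw : cexp (-(I * ((z + 2 * π * j) / n))) = w n j z := by unfold w; congr 1; ring
  rw [hw, h, sub_self, norm_zero, sq, zero_mul] at h2
  have h0 : S1 ((z + 2 * π * j) / n) = 0 := by
    rcases mul_eq_zero.mp h2.symm with h3 | h3
    · exact absurd h3 (Real.exp_pos _).ne'
    · exact norm_eq_zero.mp h3
  apply hS
  rw [Sxi_eq_sq_mul_S1, h0, mul_zero]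

/-- THE MODULUS IDENTITY `|v_n(j; z)|² = e^{Im z (1 − 1/n)} |S₁(z)| / |S_ξ(z + 2πj)|` (for real `z` this is
`|u|² = S₁/S_ξ(·+l)`, the printed (2.45)–(2.46); the exponential is the price of complex `p′`). [folklore] -/
theorem norm_v_sq (n j : ℕ) (hn : n ≠ 0) {z : ℂ} (hS : Sxi n (z + 2 * π * j) ≠ 0) :
    ‖v n j z‖ ^ 2 = Real.exp (z.im * (1 - 1 / n)) * (‖S1 z‖ / ‖Sxi n (z + 2 * π * j)‖) := by
  have hw1 : w n j z ≠ 1 := w_ne_one n j hS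
  have hn' : (n : ℂ) ≠ 0 := Nat.cast_ne_zero.mpr hn
  have hnr : (0 : ℝ) < n := by exact_mod_cast Nat.pos_of_ne_zero hn
  have hS1 : S1 ((z + 2 * π * j) / n) ≠ 0 := by
    intro h0; apply hS; rw [Sxi_eq_sq_mul_S1, h0, mul_zero]
  have hS1n : ‖S1 ((z + 2 * π * j) / n)‖ ≠ 0 := norm_ne_zero_iff.mpr hS1
  rw [v_eq_quotient n j hn hw1, norm_div, norm_mul, Complex.norm_natCast, div_pow, mul_pow,
    norm_sq_exp_sub_one z]
  have hw : w n j z = cexp (-(I * ((z + 2 * π * j) / n))) := by unfold w; congr 1; ring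
  rw [hw, norm_sq_exp_sub_one ((z + 2 * π * j) / n)]
  have him : ((z + 2 * π * (j : ℂ)) / n).im = z.im / n := by
    rw [Complex.div_natCast_im]; simp
  rw [him, Sxi_eq_sq_mul_S1, norm_mul, norm_pow, Complex.norm_natCast]
  have hexp : Real.exp z.im = Real.exp (z.im * (1 - 1 / n)) * Real.exp (z.im / n) := by
    rw [← Real.exp_add]; congr 1; field_simp; ring
  rw [hexp]
  have hB : Real.exp (z.im / n) ≠ 0 := (Real.exp_pos _).ne'
  field_simp

/-- `e^{t} < 2` for `t ≤ 1/2` (numerical: `e^{1/2} ≤ 7/4`). [folklore] -/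
theorem exp_lt_two {t : ℝ} (ht : t ≤ 1 / 2) : Real.exp t < 2 := by
  have h := Real.abs_exp_sub_one_sub_id_le (x := 1 / 2) (by rw [abs_of_pos (by norm_num)]; norm_num)
  have h2 := (abs_le.mp h).2
  calc Real.exp t ≤ Real.exp (1 / 2) := Real.exp_le_exp.mpr ht
    _ < 2 := by nlinarith

/-- `32/(j+1)² + 32/(n−j)² ≤ 64/ω_n(j)²`. [folklore] -/
theorem inv_sq_le_omega (n j : ℕ) (hjn : j < n) :
    32 / ((j : ℝ) + 1) ^ 2 + 32 / ((n : ℝ) - j) ^ 2 ≤ 64 / omega n j ^ 2 := by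
  have hω := omega_pos n j hjn
  have h1 := omega_le_left n j
  have h2 := omega_le_right n j
  have hj : (j : ℝ) + 1 ≤ n := by exact_mod_cast hjn
  have ha : 32 / ((j : ℝ) + 1) ^ 2 ≤ 32 / omega n j ^ 2 := by
    apply div_le_div_of_nonneg_left (by norm_num) (by positivity)
    exact pow_le_pow_left₀ hω.le h1 2
  have hb : 32 / ((n : ℝ) - j) ^ 2 ≤ 32 / omega n j ^ 2 := by
    apply div_le_div_of_nonneg_left (by norm_num) (by positivity)
    exact pow_le_pow_left₀ hω.le h2 2
  calc 32 / ((j : ℝ) + 1) ^ 2 + 32 / ((n : ℝ) - j) ^ 2 ≤ 32 / omega n j ^ 2 + 32 / omega n j ^ 2 :=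
        add_le_add ha hb
    _ = 64 / omega n j ^ 2 := by ring

/-- **ONE-COORDINATE MODULUS BOUND** `|v_n(j; z)| ≤ 12/ω_n(j)` on the fat box `|Re z| ≤ π + r`, `|Im z| ≤ 2r`
(`r ≤ 1/4`), uniformly in `n ≥ 1` — the square root of the residue decay `|u|² ≲ 1/|m|²` of (2.51). [folklore] -/
theorem norm_v_le (n : ℕ) [NeZero n] (j : Fin n) {z : ℂ} {r : ℝ} (hr : r ≤ 1 / 4)
    (hx : |z.re| ≤ π + r) (hy : |z.im| ≤ 2 * r) : ‖v n j z‖ ≤ 12 / omega n j := by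
  have hn : 1 ≤ n := Nat.one_le_iff_ne_zero.mpr (NeZero.ne n)
  have hn0 : n ≠ 0 := NeZero.ne n
  have hn' : (n : ℂ) ≠ 0 := Nat.cast_ne_zero.mpr hn0
  have hjn : (j : ℕ) + 1 ≤ n := j.isLt
  have hωpos : 0 < omega n j := omega_pos n j j.isLt
  have hω1 : 1 ≤ omega n j := one_le_omega n j j.isLt
  have hexp : Real.exp (z.im * (1 - 1 / n)) ≤ 2 := by
    refine (exp_lt_two ?_).le
    have hn1 : (0 : ℝ) ≤ 1 - 1 / n := by
      have : (1 : ℝ) ≤ n := by exact_mod_cast hn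
      have : 1 / (n : ℝ) ≤ 1 := by rw [div_le_one (by positivity)]; exact this
      linarith
    have hn2 : 1 - 1 / (n : ℝ) ≤ 1 := by
      have : (0 : ℝ) ≤ 1 / n := by positivity
      linarith
    have : z.im ≤ 1 / 2 := (le_abs_self _).trans (by linarith)
    nlinarith
  have hsq : ‖v n j z‖ ^ 2 ≤ (12 / omega n j) ^ 2 := by
    by_cases hj : (j : ℕ) = 0
    · rw [hj, omega_zero n hn]
      by_cases hz : z = 0
      · have hw : w n 0 z = 1 := by unfold w; rw [hz]; simp
        have hv : v n 0 z = 1 := by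
          unfold v; rw [hw]; simp [hn']
        rw [hv]; norm_num
      · have hx2 : |z.re| < 2 * π := by linarith [Real.pi_gt_three]
        have hS : Sxi n (z + 2 * π * ((0 : ℕ) : ℂ)) ≠ 0 := by
          simp only [Nat.cast_zero, mul_zero, add_zero]
          exact Sxi_ne_zero n hn hx2 hz
        rw [norm_v_sq n 0 hn0 hS]
        have hq : ‖S1 z‖ / ‖Sxi n (z + 2 * π * ((0 : ℕ) : ℂ))‖ ≤ 4 := by
          have h4 := norm_uFactor_zero_le n hn hr hx hy
          rw [uFactor_zero_eq, if_neg hz, norm_div] at h4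
          simpa using h4
        have hq0 : 0 ≤ ‖S1 z‖ / ‖Sxi n (z + 2 * π * ((0 : ℕ) : ℂ))‖ := by positivity
        nlinarith [Real.exp_pos (z.im * (1 - 1 / n))]
    · have hj1 : 1 ≤ (j : ℕ) := Nat.one_le_iff_ne_zero.mpr hj
      have hS : Sxi n (z + 2 * π * ((j : ℕ) : ℂ)) ≠ 0 := Sxi_shift_ne_zero n j hj1 hjn hr hx
      rw [norm_v_sq n j hn0 hS]
      have hq : ‖S1 z‖ / ‖Sxi n (z + 2 * π * ((j : ℕ) : ℂ))‖ ≤ 64 / omega n j ^ 2 := by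
        have h := norm_uFactor_ne_le n j hj1 hjn hr hx hy
        rw [uFactor_ne_eq n j hj, norm_div] at h
        exact h.trans (inv_sq_le_omega n j j.isLt)
      have hq0 : 0 ≤ ‖S1 z‖ / ‖Sxi n (z + 2 * π * ((j : ℕ) : ℂ))‖ := by positivity
      rw [div_pow]
      have : Real.exp (z.im * (1 - 1 / ↑n)) * (‖S1 z‖ / ‖Sxi n (z + 2 * π * ((j : ℕ) : ℂ))‖)
          ≤ 2 * (64 / omega n j ^ 2) :=
        mul_le_mul hexp hq hq0 (by norm_num)
      have h144 : 2 * (64 / omega n ↑j ^ 2) ≤ 12 ^ 2 / omega n j ^ 2 := by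
        rw [show 2 * (64 / omega n ↑j ^ 2) = 128 / omega n j ^ 2 by ring]
        gcongr; norm_num
      exact this.trans h144
  exact (pow_le_pow_iff_left₀ (norm_nonneg _) (by positivity) two_ne_zero).mp hsq

/-- `|ef| ≤ 2` on `|Im z| ≤ 1/2` for `t ≤ n`. [folklore] -/
theorem norm_ef_le (n j t : ℕ) (htn : t ≤ n) {z : ℂ} (hy : |z.im| ≤ 1 / 2) : ‖ef n j t z‖ ≤ 2 := by
  unfold ef
  rw [Complex.norm_exp]
  refine (exp_lt_two ?_).le
  have hre : (I * (z + 2 * π * j) * t / n).re = -(z.im * t / n) := by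
    simp [Complex.mul_re, Complex.mul_im, mul_div_assoc]
  rw [hre]
  rcases Nat.eq_zero_or_pos n with h0 | hpos
  · subst h0; simp
  · have hnr : (0 : ℝ) < n := by exact_mod_cast hpos
    have ht : (t : ℝ) / n ≤ 1 := by
      rw [div_le_one hnr]; exact_mod_cast htn
    have ht0 : 0 ≤ (t : ℝ) / n := by positivity
    have : -(z.im * t / n) = (-z.im) * (t / n) := by ring
    rw [this]
    have hzi : -z.im ≤ 1 / 2 := (neg_le_abs _).trans hy
    nlinarith


/-! ### §2 The residue weights: quadratic growth of the shifted denominators, and the `n`-uniform residue sums -/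

/-- `W_n(k) = Σ_{ν : k_ν ≠ 0} ω_n(k_ν)²` — the quadratic size of a non-zero residue vector. [folklore] -/
def W (n : ℕ) (k : Fin d → Fin n) : ℝ := ∑ ν, if (k ν : ℕ) = 0 then 0 else omega n (k ν) ^ 2

/-- `W_n(k) ≥ 0`. [folklore] -/
theorem W_nonneg (n : ℕ) (k : Fin d → Fin n) : 0 ≤ W n k := by
  unfold W
  refine Finset.sum_nonneg (fun ν _ => ?_)
  split_ifs
  · exact le_rfl
  · positivity

/-- `W_n(k) ≥ 1` for `k ≠ 0` (one coordinate has `k_ν ≠ 0`, `ω ≥ 1` there). [folklore] -/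
theorem one_le_W (n : ℕ) [NeZero n] (k : Fin d → Fin n) (hk : k ≠ fun _ => 0) : 1 ≤ W n k := by
  obtain ⟨ν₀, hν₀⟩ := Function.ne_iff.mp hk
  have hk0 : (k ν₀ : ℕ) ≠ 0 := fun h => hν₀ (Fin.ext (by rw [h, Fin.val_zero]))
  have hω := one_le_omega n (k ν₀) (k ν₀).isLt
  have hsingle := Finset.single_le_sum
    (f := fun ν => if (k ν : ℕ) = 0 then (0 : ℝ) else omega n (k ν) ^ 2)
    (fun ν _ => by
      show 0 ≤ (if (k ν : ℕ) = 0 then (0 : ℝ) else omega n (k ν) ^ 2)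
      split_ifs
      · exact le_rfl
      · positivity) (Finset.mem_univ ν₀)
  simp only [hk0, if_false] at hsingle
  unfold W
  nlinarith

/-- every coordinate weight is dominated by `W` (for `k ≠ 0`; at `k_ν = 0` the weight is `ω(0) = 1 ≤ W`). [folklore] -/
theorem omega_sq_le_W (n : ℕ) [NeZero n] (k : Fin d → Fin n) (hk : k ≠ fun _ => 0) (ν : Fin d) :
    omega n (k ν) ^ 2 ≤ W n k := by
  have hn : 1 ≤ n := Nat.one_le_iff_ne_zero.mpr (NeZero.ne n)
  have hW1 := one_le_W n k hk
  by_cases hkν : (k ν : ℕ) = 0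
  · rw [hkν, omega_zero n hn, one_pow]; exact hW1
  · have hsingle := Finset.single_le_sum
      (f := fun μ => if (k μ : ℕ) = 0 then (0 : ℝ) else omega n (k μ) ^ 2)
      (fun μ _ => by
        show 0 ≤ (if (k μ : ℕ) = 0 then (0 : ℝ) else omega n (k μ) ^ 2)
        split_ifs
        · exact le_rfl
        · positivity) (Finset.mem_univ ν)
    simp only [hkν, if_false] at hsingle
    exact hsingle

/-- **QUADRATIC GROWTH OF THE SHIFTED DENOMINATOR**: `Re (Δ^ξ+m²)(q + 2πk) ≥ (7/64) W_n(k)` on the fat region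
`F_r` (`r ≤ 1/4`, `d r² ≤ 1/16`), `k ≠ 0`, uniformly in `n` — the quantitative form of `B4StripCauchy.re_DeltaXi_shift_ge`
(the printed "from |Δ(p′+l)| ≥ O(1)|l|²", (2.51) p. 586). [folklore] -/
theorem re_DeltaXi_shift_ge_W (n : ℕ) [NeZero n] (m2 : ℝ) (hm : 0 ≤ m2) {r : ℝ}
    (hr : r ≤ 1 / 4) (hdr : (d : ℝ) * r ^ 2 ≤ 1 / 16) {q : Fin d → ℂ} (hq : q ∈ Fat d r)
    (k : Fin d → Fin n) (hk : k ≠ fun _ => 0) :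
    7 / 64 * W n k ≤ (DeltaXi n m2 (shift n k q)).re := by
  have hn : 1 ≤ n := Nat.one_le_iff_ne_zero.mpr (NeZero.ne n)
  simp only [DeltaXi, shift]
  rw [Complex.add_re, Complex.re_sum, Complex.ofReal_re]
  have hlow : ∀ ν, 1 / 2 * (if (k ν : ℕ) = 0 then (0 : ℝ) else omega n (k ν) ^ 2) - 25 / 16 * (q ν).im ^ 2 ≤
      (Sxi n (q ν + 2 * Real.pi * ((k ν : ℕ) : ℂ))).re := by
    intro ν
    have hy : |(q ν).im| ≤ 1 := by linarith [(hq ν).2]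
    have base := re_Sxi_ge n hn (q ν + 2 * Real.pi * ((k ν : ℕ) : ℂ)) (by rw [shiftc_im]; exact hy)
    rw [shiftc_re, shiftc_im] at base
    by_cases hkν : (k ν : ℕ) = 0
    · rw [if_pos hkν]
      have : 0 ≤ 4 * (n : ℝ) ^ 2 *
          Real.sin (((q ν).re + 2 * Real.pi * ((k ν : ℕ) : ℝ)) / (2 * n)) ^ 2 := by positivity
      linarith
    · rw [if_neg hkν]
      have hj : 1 ≤ (k ν : ℕ) := Nat.one_le_iff_ne_zero.mpr hkν
      have hjn : (k ν : ℕ) + 1 ≤ n := (k ν).isLt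
      have hss := (shifted_sin_sq_ge n (k ν) hj hjn hr (hq ν).1).2
      have hω := omega_pos n (k ν) (k ν).isLt
      have hω1 : omega n (k ν) ^ 2 ≤ (((k ν : ℕ) : ℝ) + 1) ^ 2 :=
        pow_le_pow_left₀ hω.le (omega_le_left n (k ν)) 2
      have hω2 : omega n (k ν) ^ 2 ≤ ((n : ℝ) - (k ν : ℕ)) ^ 2 :=
        pow_le_pow_left₀ hω.le (omega_le_right n (k ν)) 2
      rcases hss with h | h <;> linarith
  have hsum := Finset.sum_le_sum (fun ν (_ : ν ∈ Finset.univ) => hlow ν)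
  rw [Finset.sum_sub_distrib, ← Finset.mul_sum, ← Finset.mul_sum] at hsum
  have him2 : ∑ ν, (q ν).im ^ 2 ≤ d * (2 * r) ^ 2 := by
    calc ∑ ν, (q ν).im ^ 2 ≤ ∑ _ν : Fin d, (2 * r) ^ 2 := by
          apply Finset.sum_le_sum; intro ν _
          rw [← sq_abs]; exact pow_le_pow_left₀ (abs_nonneg _) (hq ν).2 2
      _ = d * (2 * r) ^ 2 := by simp
  have hW := one_le_W n k hk
  have hWdef : W n k = ∑ ν, if (k ν : ℕ) = 0 then (0 : ℝ) else omega n (k ν) ^ 2 := rfl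
  rw [← hWdef] at hsum
  nlinarith

/-- the shifted denominators do not vanish on the fat region. [folklore] -/
theorem DeltaXi_shift_ne_zero (n : ℕ) [NeZero n] (m2 : ℝ) (hm : 0 ≤ m2) {r : ℝ}
    (hr : r ≤ 1 / 4) (hdr : (d : ℝ) * r ^ 2 ≤ 1 / 16) {q : Fin d → ℂ} (hq : q ∈ Fat d r)
    (k : Fin d → Fin n) (hk : k ≠ fun _ => 0) : DeltaXi n m2 (shift n k q) ≠ 0 := by
  intro h
  have := re_DeltaXi_shift_ge n m2 hm hr hdr hq k hk
  rw [h, Complex.zero_re] at this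
  linarith

/-- `1/W_n(k) ≤ Π_ν ω_n(k_ν)^{-2/d}` (`k ≠ 0`): the quadratic gain distributed over the coordinates with real
exponents (the audit's form of Bałaban's "(2.51)" bookkeeping). [folklore] -/
theorem inv_W_le_prod_rpow (n : ℕ) [NeZero n] (hd : 0 < d) (k : Fin d → Fin n) (hk : k ≠ fun _ => 0) :
    1 / W n k ≤ ∏ ν, omega n (k ν) ^ (-(2 : ℝ) / d) := by
  have hW1 := one_le_W n k hk
  have hW0 : 0 < W n k := by linarith
  have hdr : (0 : ℝ) < d := by exact_mod_cast hd
  have hprod : ∏ _ν : Fin d, W n k ^ (-(1 : ℝ) / d) = (W n k)⁻¹ := by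
    rw [Finset.prod_const, Finset.card_univ, Fintype.card_fin, ← Real.rpow_natCast,
      ← Real.rpow_mul hW0.le]
    have : (-(1 : ℝ) / d) * (d : ℝ) = -1 := by field_simp
    rw [this, Real.rpow_neg_one]
  rw [one_div, ← hprod]
  refine Finset.prod_le_prod (fun ν _ => Real.rpow_nonneg hW0.le _) (fun ν _ => ?_)
  have hω := omega_pos n (k ν) (k ν).isLt
  have hexp : -(1 : ℝ) / d ≤ 0 := div_nonpos_of_nonpos_of_nonneg (by norm_num) hdr.le
  calc W n k ^ (-(1 : ℝ) / d) ≤ (omega n (k ν) ^ 2) ^ (-(1 : ℝ) / d) :=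
        Real.rpow_le_rpow_of_nonpos (by positivity) (omega_sq_le_W n k hk ν) hexp
    _ = omega n (k ν) ^ (-(2 : ℝ) / d) := by
        rw [← Real.rpow_natCast, ← Real.rpow_mul hω.le]
        congr 1; push_cast; ring

/-- the constant `ζ_d = Σ_{i ≥ 1} i^{-(1+2/d)}` of the residue sums. [folklore] -/
def zetaC (d : ℕ) : ℝ := ∑' i : ℕ, (i : ℝ) ^ (-(1 + 2 / (d : ℝ)))

/-- `ζ_d ≥ 0`. [folklore] -/
theorem zetaC_nonneg (d : ℕ) : 0 ≤ zetaC d :=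
  tsum_nonneg (fun i => Real.rpow_nonneg (Nat.cast_nonneg i) _)

/-- the `p`-series with `p = 1 + 2/d > 1` converges (`Real.summable_nat_rpow`). [folklore] -/
theorem summable_zetaC (hd : 0 < d) : Summable (fun i : ℕ => (i : ℝ) ^ (-(1 + 2 / (d : ℝ)))) := by
  apply Real.summable_nat_rpow.mpr
  have : (0 : ℝ) < 2 / d := by
    have : (0 : ℝ) < d := by exact_mod_cast hd
    positivity
  linarith

/-- a partial `p`-series is bounded by the series. [folklore] -/
theorem sum_rpow_le_zetaC (hd : 0 < d) (n : ℕ) :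
    ∑ j : Fin n, (((j : ℕ) : ℝ) + 1) ^ (-(1 + 2 / (d : ℝ))) ≤ zetaC d := by
  set e := -(1 + 2 / (d : ℝ)) with he
  have he0 : e ≠ 0 := by
    have : (0 : ℝ) < d := by exact_mod_cast hd
    have : (0 : ℝ) < 2 / d := by positivity
    rw [he]; linarith
  have hs : Summable (fun m : ℕ => (m : ℝ) ^ e) := summable_zetaC hd
  have hs1 : Summable (fun m : ℕ => ((m + 1 : ℕ) : ℝ) ^ e) := (summable_nat_add_iff 1).mpr hs
  have h1 : ∑ j : Fin n, (((j : ℕ) : ℝ) + 1) ^ e = ∑ i ∈ Finset.range n, ((i : ℝ) + 1) ^ e :=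
    Fin.sum_univ_eq_sum_range (fun i => ((i : ℝ) + 1) ^ e) n
  have h2 : ∑ i ∈ Finset.range n, ((i : ℝ) + 1) ^ e = ∑ i ∈ Finset.range n, ((i + 1 : ℕ) : ℝ) ^ e := by
    refine Finset.sum_congr rfl (fun i _ => ?_); push_cast; rfl
  have h3 : ∑ i ∈ Finset.range n, ((i + 1 : ℕ) : ℝ) ^ e ≤ ∑' m : ℕ, ((m + 1 : ℕ) : ℝ) ^ e :=
    hs1.sum_le_tsum (Finset.range n) (fun m _ => Real.rpow_nonneg (Nat.cast_nonneg _) _)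
  have h4 : ∑' m : ℕ, ((m + 1 : ℕ) : ℝ) ^ e = zetaC d := by
    rw [zetaC, ← he, hs.tsum_eq_zero_add]
    simp [Real.zero_rpow he0]
  linarith [h1, h2, h3, h4]

/-- reflection `j ↦ n-1-j` of the residues. [folklore] -/
theorem sum_reflect_rpow (n : ℕ) (e : ℝ) :
    ∑ j : Fin n, ((n : ℝ) - (j : ℕ)) ^ e = ∑ j : Fin n, (((j : ℕ) : ℝ) + 1) ^ e := by
  refine Fintype.sum_equiv Fin.revPerm _ _ (fun j => ?_)
  have hj : (j : ℕ) + 1 ≤ n := j.isLt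
  rw [Fin.revPerm_apply, Fin.val_rev, Nat.cast_sub hj]
  congr 1
  push_cast
  ring

/-- **THE `n`-UNIFORM RESIDUE SUM**: `Σ_{j ∈ ℤ_n} ω_n(j)^{-(1+2/d)} ≤ 2 ζ_d`. [folklore] -/
theorem sum_omega_rpow_le (n : ℕ) (hd : 0 < d) :
    ∑ j : Fin n, omega n j ^ (-(1 + 2 / (d : ℝ))) ≤ 2 * zetaC d := by
  set e := -(1 + 2 / (d : ℝ)) with he
  have hterm : ∀ j : Fin n, omega n j ^ e ≤ (((j : ℕ) : ℝ) + 1) ^ e + ((n : ℝ) - (j : ℕ)) ^ e := by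
    intro j
    have hjn : ((j : ℕ) : ℝ) + 1 ≤ n := by exact_mod_cast j.isLt
    have ha : 0 ≤ (((j : ℕ) : ℝ) + 1) ^ e := Real.rpow_nonneg (by positivity) _
    have hb : 0 ≤ ((n : ℝ) - (j : ℕ)) ^ e := Real.rpow_nonneg (by linarith) _
    unfold omega
    rcases min_choice (((j : ℕ) : ℝ) + 1) ((n : ℝ) - (j : ℕ)) with h | h <;> rw [h] <;> linarith
  calc ∑ j : Fin n, omega n j ^ e
      ≤ ∑ j : Fin n, ((((j : ℕ) : ℝ) + 1) ^ e + ((n : ℝ) - (j : ℕ)) ^ e) :=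
        Finset.sum_le_sum (fun j _ => hterm j)
    _ = 2 * ∑ j : Fin n, (((j : ℕ) : ℝ) + 1) ^ e := by
        rw [Finset.sum_add_distrib, sum_reflect_rpow]; ring
    _ ≤ 2 * zetaC d := by
        have := sum_rpow_le_zetaC hd n
        linarith

/-! ### §3 The regrouped multiplier of (2.48) and its uniform bound on the fat region -/

/-- `F_{n,τ}(k; p) = Π_ν e^{i(p_ν + 2πk_ν)τ_ν/n} v_n(k_ν; p_ν)` — the numerator `e^{i(p′+l)·(x−x⁰)} u_j(p′+l)` of
(2.48) at the block offset `τ = n(x − x⁰)`, as an entire function of `p′`. [cite: Balaban1983RegularityDecay, (2.48) p.585] -/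
def F (n : ℕ) (τ k : Fin d → Fin n) (p : Fin d → ℂ) : ℂ :=
  ∏ ν, (ef n (k ν : ℕ) (τ ν : ℕ) (p ν) * v n (k ν : ℕ) (p ν))

/-- `R_{n,m²}(k; p′) = 1` (`k = 0`), `= (Δ^ξ+m²)(p′)/(Δ^ξ+m²)(p′+2πk)` (`k ≠ 0`): the REGROUPED ratio — together with
`1/E` it is the printed `1/[(Δ^ξ(p′+l)+m²)(1 + a Σ_{l′} …)]` of (2.48) (`R_div_E_eq_printed`), but holomorphic on the
strip (the printed factors are not, `B4Strip.printed_factor_has_poles`). [cite: Balaban1983RegularityDecay, (2.48) p.585 (regrouped by the audit)] -/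
def R (n : ℕ) [NeZero n] (m2 : ℝ) (k : Fin d → Fin n) (p : Fin d → ℂ) : ℂ :=
  if k = fun _ => (0 : Fin n) then 1 else DeltaXi n m2 p / DeltaXi n m2 (shift n k p)

/-- one term of the `l`-sum of (2.48) (regrouped): `F · R / E`. [cite: Balaban1983RegularityDecay, (2.48) p.585 (regrouped by the audit)] -/
def term (n : ℕ) [NeZero n] (a m2 : ℝ) (τ k : Fin d → Fin n) (p : Fin d → ℂ) : ℂ :=
  F n τ k p * R n m2 k p / E n a m2 p

/-- THE FOURIER MULTIPLIER OF `G_j Q_j^*` AT BLOCK OFFSET `τ`: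
`G_{n,a,m²,τ}(p′) = Σ_{k ∈ {0..n-1}^d} e^{i(p′+2πk)·τ/n} u(p′+2πk) R_k(p′)/E(p′)` — the `l`-sum of (2.48) with the
denominator regrouped through `E`; for `x = x⁰ + τ/n`, `x⁰ ∈ ℤ^d`, `x′ ∈ ℤ^d` the printed kernel is
`(G_jQ_j^*)(x, x′) = (2π)^{-d} ∫_{[-π,π]^d} G_{n,a,m²,τ}(p′) e^{ip′(x⁰−x′)} dp′ = latticeKernel G (x⁰ − x′)`.
[cite: Balaban1983RegularityDecay, (2.48) p.585 (regrouped by the audit)] -/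
def G (n : ℕ) [NeZero n] (a m2 : ℝ) (τ : Fin d → Fin n) (p : Fin d → ℂ) : ℂ :=
  ∑ k : Fin d → Fin n, term n a m2 τ k p

/-- the constant of the `R`-bound. [folklore] -/
def CR (d : ℕ) (m2 : ℝ) : ℝ := (16 * d + m2) * (64 / 7) + 1

/-- `C_R ≥ 0`. [folklore] -/
theorem CR_nonneg (d : ℕ) {m2 : ℝ} (hm : 0 ≤ m2) : 0 ≤ CR d m2 := by
  unfold CR
  have : (0 : ℝ) ≤ d := Nat.cast_nonneg d
  nlinarith

/-- `C_R` is monotone in `m²`. [folklore] -/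
theorem CR_mono (d : ℕ) {m2 m2' : ℝ} (h : m2 ≤ m2') : CR d m2 ≤ CR d m2' := by
  unfold CR; nlinarith

/-- THE DICTIONARY WITH (2.48): where `(Δ^ξ+m²)(p′) ≠ 0` and `(Δ^ξ+m²)(p′+2πk) ≠ 0`,
`R_k(p′)/E(p′) = 1/[(Δ^ξ+m²)(p′+2πk) · (1 + a Σ_{l′} |u(p′+l′)|² (Δ^ξ(p′+l′)+m²)^{-1})]` — the printed denominator of
(2.48) (`B5Strip145Analytic.Bfac` is the bracket, `B4Strip.E_eq_mul`). [cite: Balaban1983RegularityDecay, (2.48) p.585] -/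
theorem R_div_E_eq_printed (n : ℕ) [NeZero n] (a m2 : ℝ) (k : Fin d → Fin n) (p : Fin d → ℂ)
    (h0 : DeltaXi n m2 p ≠ 0) (hk : DeltaXi n m2 (shift n k p) ≠ 0) (hB : Bfac n a m2 p ≠ 0) :
    R n m2 k p / E n a m2 p = 1 / (DeltaXi n m2 (shift n k p) * Bfac n a m2 p) := by
  have hR : R n m2 k p = DeltaXi n m2 p / DeltaXi n m2 (shift n k p) := by
    unfold R
    split_ifs with h
    · rw [h, shift_zero, div_self h0]
    · rfl
  rw [hR, E_eq_DeltaXi_mul_Bfac n a m2 p h0]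
  field_simp

/-- `R_k = (Δ^ξ+m²)(p′)/(Δ^ξ+m²)(p′+2πk)` for every `k` wherever `(Δ^ξ+m²)(p′) ≠ 0`. [folklore] -/
theorem R_eq_div (n : ℕ) [NeZero n] (m2 : ℝ) (k : Fin d → Fin n) (p : Fin d → ℂ) (h0 : DeltaXi n m2 p ≠ 0) :
    R n m2 k p = DeltaXi n m2 p / DeltaXi n m2 (shift n k p) := by
  unfold R
  split_ifs with h
  · rw [h, shift_zero, div_self h0]
  · rfl

/-- THE DICTIONARY WITH (2.48), whole summand: where `(Δ^ξ+m²)(p′)`, `(Δ^ξ+m²)(p′+2πk)` and the bracket `B` do not vanish,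
`term_k(p′) = e^{i(p′+l)·ξτ} u_j(p′+l) / [(Δ^ξ+m²)(p′+l) · (1 + a Σ_{l′} |u_j(p′+l′)|² (Δ^ξ(p′+l′)+m²)^{-1})]`, `l = 2πk`.
[cite: Balaban1983RegularityDecay, (2.48) p.585] -/
theorem term_eq_printed (n : ℕ) [NeZero n] (a m2 : ℝ) (τ k : Fin d → Fin n) (p : Fin d → ℂ)
    (h0 : DeltaXi n m2 p ≠ 0) (hk : DeltaXi n m2 (shift n k p) ≠ 0) (hB : Bfac n a m2 p ≠ 0) :
    term n a m2 τ k p = F n τ k p / (DeltaXi n m2 (shift n k p) * Bfac n a m2 p) := by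
  unfold term
  rw [mul_div_assoc, R_div_E_eq_printed n a m2 k p h0 hk hB]
  ring

/-- `|F_{n,τ}(k; p)| ≤ Π_ν 24/ω_n(k_ν)` on the fat region. [folklore] -/
theorem norm_F_le (n : ℕ) [NeZero n] {r : ℝ} (hr : r ≤ 1 / 4) (τ k : Fin d → Fin n) {p : Fin d → ℂ}
    (hp : p ∈ Fat d r) : ‖F n τ k p‖ ≤ ∏ ν, 24 / omega n (k ν) := by
  unfold F
  rw [norm_prod]
  refine Finset.prod_le_prod (fun _ _ => norm_nonneg _) (fun ν _ => ?_)
  rw [norm_mul]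
  have h1 := norm_ef_le n (k ν) (τ ν) (τ ν).isLt.le (z := p ν) (by linarith [(hp ν).2])
  have h2 := norm_v_le n (k ν) hr (hp ν).1 (hp ν).2
  have hω := omega_pos n (k ν) (k ν).isLt
  calc ‖ef n (k ν) (τ ν) (p ν)‖ * ‖v n (k ν) (p ν)‖ ≤ 2 * (12 / omega n (k ν)) :=
        mul_le_mul h1 h2 (norm_nonneg _) (by norm_num)
    _ = 24 / omega n (k ν) := by ring

/-- `|R_k| ≤ (16d + m²)(64/7)/W_n(k)` on the fat region, `k ≠ 0`. [folklore] -/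
theorem norm_R_le (n : ℕ) [NeZero n] (m2 : ℝ) (hm : 0 ≤ m2) {r : ℝ} (hr : r ≤ 1 / 4)
    (hdr : (d : ℝ) * r ^ 2 ≤ 1 / 16) {q : Fin d → ℂ} (hq : q ∈ Fat d r) (k : Fin d → Fin n)
    (hk : k ≠ fun _ => 0) : ‖R n m2 k q‖ ≤ (16 * d + m2) * (64 / 7) / W n k := by
  have hn : 1 ≤ n := Nat.one_le_iff_ne_zero.mpr (NeZero.ne n)
  unfold R
  rw [if_neg hk, norm_div]
  have hW1 := one_le_W n k hk
  have hden : 7 / 64 * W n k ≤ ‖DeltaXi n m2 (shift n k q)‖ :=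
    (re_DeltaXi_shift_ge_W n m2 hm hr hdr hq k hk).trans (Complex.re_le_norm _)
  have hnum := norm_DeltaXi_le n hn m2 hm hr hq
  have hpos : 0 < 7 / 64 * W n k := by linarith
  have hd0 : (0 : ℝ) ≤ 16 * d + m2 := by
    have : (0 : ℝ) ≤ d := Nat.cast_nonneg d
    linarith
  calc ‖DeltaXi n m2 q‖ / ‖DeltaXi n m2 (shift n k q)‖ ≤ (16 * d + m2) / (7 / 64 * W n k) :=
        div_le_div₀ hd0 hnum hpos hden
    _ = (16 * d + m2) * (64 / 7) / W n k := by
        field_simp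

/-- `|R_k| ≤ C_R Π_ν ω_n(k_ν)^{-2/d}` for EVERY `k` (product form of the quadratic gain). [folklore] -/
theorem norm_R_le_prod (n : ℕ) [NeZero n] (hd : 0 < d) (m2 : ℝ) (hm : 0 ≤ m2) {r : ℝ} (hr : r ≤ 1 / 4)
    (hdr : (d : ℝ) * r ^ 2 ≤ 1 / 16) {q : Fin d → ℂ} (hq : q ∈ Fat d r) (k : Fin d → Fin n) :
    ‖R n m2 k q‖ ≤ CR d m2 * ∏ ν, omega n (k ν) ^ (-(2 : ℝ) / d) := by
  have hn : 1 ≤ n := Nat.one_le_iff_ne_zero.mpr (NeZero.ne n)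
  have hd0 : (0 : ℝ) ≤ (16 * d + m2) * (64 / 7) := by
    have : (0 : ℝ) ≤ d := Nat.cast_nonneg d
    nlinarith
  by_cases hk : k = fun _ => 0
  · have h1 : ‖R n m2 k q‖ = 1 := by unfold R; rw [if_pos hk, norm_one]
    have h2 : ∏ ν, omega n (k ν) ^ (-(2 : ℝ) / d) = 1 := by
      apply Finset.prod_eq_one
      intro ν _
      rw [hk]
      simp only [Fin.val_zero, omega_zero n hn, Real.one_rpow]
    rw [h1, h2, mul_one]
    unfold CR
    linarith
  · have h1 := norm_R_le n m2 hm hr hdr hq k hk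
    have h2 := inv_W_le_prod_rpow n hd k hk
    have hP0 : 0 ≤ ∏ ν, omega n (k ν) ^ (-(2 : ℝ) / d) :=
      Finset.prod_nonneg (fun ν _ => Real.rpow_nonneg (omega_pos n (k ν) (k ν).isLt).le _)
    calc ‖R n m2 k q‖ ≤ (16 * d + m2) * (64 / 7) / W n k := h1
      _ = (16 * d + m2) * (64 / 7) * (1 / W n k) := by ring
      _ ≤ (16 * d + m2) * (64 / 7) * ∏ ν, omega n (k ν) ^ (-(2 : ℝ) / d) :=
          mul_le_mul_of_nonneg_left h2 hd0
      _ ≤ CR d m2 * ∏ ν, omega n (k ν) ^ (-(2 : ℝ) / d) :=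
          mul_le_mul_of_nonneg_right (by unfold CR; linarith) hP0

/-- the bound of one term: `|F·R/E| ≤ c⁻¹ C_R Π_ν 24 ω_n(k_ν)^{-(1+2/d)}` on the fat region where `|E| ≥ c`. [folklore] -/
theorem norm_term_le (n : ℕ) [NeZero n] (hd : 0 < d) (a m2 : ℝ) (hm : 0 ≤ m2) {r : ℝ} (hr : r ≤ 1 / 4)
    (hdr : (d : ℝ) * r ^ 2 ≤ 1 / 16) {p : Fin d → ℂ} (hp : p ∈ Fat d r) {c : ℝ} (hc : 0 < c)
    (hE : c ≤ ‖E n a m2 p‖) (τ k : Fin d → Fin n) :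
    ‖term n a m2 τ k p‖ ≤ c⁻¹ * CR d m2 * ∏ ν, 24 * omega n (k ν) ^ (-(1 + 2 / (d : ℝ))) := by
  unfold term
  rw [norm_div, norm_mul]
  have hF := norm_F_le n hr τ k hp
  have hR := norm_R_le_prod n hd m2 hm hr hdr hp k
  have hE' : ‖E n a m2 p‖⁻¹ ≤ c⁻¹ := inv_anti₀ hc hE
  have hP1 : 0 ≤ ∏ ν, 24 / omega n (k ν) :=
    Finset.prod_nonneg (fun ν _ => div_nonneg (by norm_num) (omega_pos n (k ν) (k ν).isLt).le)
  have hP0 : 0 ≤ ∏ ν, omega n (k ν) ^ (-(2 : ℝ) / d) :=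
    Finset.prod_nonneg (fun ν _ => Real.rpow_nonneg (omega_pos n (k ν) (k ν).isLt).le _)
  have hCR := CR_nonneg d hm
  have hprod : (∏ ν, 24 / omega n (k ν)) * ∏ ν, omega n (k ν) ^ (-(2 : ℝ) / d)
      = ∏ ν, 24 * omega n (k ν) ^ (-(1 + 2 / (d : ℝ))) := by
    rw [← Finset.prod_mul_distrib]
    refine Finset.prod_congr rfl (fun ν _ => ?_)
    have hω := omega_pos n (k ν) (k ν).isLt
    rw [div_eq_mul_inv, ← Real.rpow_neg_one, mul_assoc, ← Real.rpow_add hω]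
    congr 1
    ring_nf
  calc ‖F n τ k p‖ * ‖R n m2 k p‖ / ‖E n a m2 p‖
      = ‖F n τ k p‖ * ‖R n m2 k p‖ * ‖E n a m2 p‖⁻¹ := div_eq_mul_inv _ _
    _ ≤ ((∏ ν, 24 / omega n (k ν)) * (CR d m2 * ∏ ν, omega n (k ν) ^ (-(2 : ℝ) / d))) * c⁻¹ := by
        apply mul_le_mul (mul_le_mul hF hR (norm_nonneg _) hP1) hE' (inv_nonneg.mpr (norm_nonneg _))
        positivity
    _ = c⁻¹ * CR d m2 * ((∏ ν, 24 / omega n (k ν)) * ∏ ν, omega n (k ν) ^ (-(2 : ℝ) / d)) := by ring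
    _ = c⁻¹ * CR d m2 * ∏ ν, 24 * omega n (k ν) ^ (-(1 + 2 / (d : ℝ))) := by rw [hprod]

/-- **THE `n`-UNIFORM MULTIPLIER SUM**: `Σ_k Π_ν 24 ω_n(k_ν)^{-(1+2/d)} = (Σ_j 24 ω_n(j)^{-(1+2/d)})^d ≤ (48 ζ_d)^d`.
[folklore] -/
theorem sum_prod_le (n : ℕ) (hd : 0 < d) :
    ∑ k : Fin d → Fin n, ∏ ν, 24 * omega n (k ν) ^ (-(1 + 2 / (d : ℝ))) ≤ (48 * zetaC d) ^ d := by
  have h := Finset.prod_univ_sum (fun _ : Fin d => (Finset.univ : Finset (Fin n)))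
    (fun _ j => 24 * omega n (j : ℕ) ^ (-(1 + 2 / (d : ℝ))))
  rw [Fintype.piFinset_univ] at h
  rw [← h]
  have hS : ∑ j : Fin n, 24 * omega n (j : ℕ) ^ (-(1 + 2 / (d : ℝ))) ≤ 48 * zetaC d := by
    rw [← Finset.mul_sum]
    have := sum_omega_rpow_le n hd (d := d)
    linarith
  have hS0 : 0 ≤ ∑ j : Fin n, 24 * omega n (j : ℕ) ^ (-(1 + 2 / (d : ℝ))) :=
    Finset.sum_nonneg (fun j _ => mul_nonneg (by norm_num) (Real.rpow_nonneg (omega_pos n j j.isLt).le _))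
  calc ∏ _ν : Fin d, ∑ j : Fin n, 24 * omega n (j : ℕ) ^ (-(1 + 2 / (d : ℝ)))
      ≤ ∏ _ν : Fin d, (48 * zetaC d) := Finset.prod_le_prod (fun _ _ => hS0) (fun _ _ => hS)
    _ = (48 * zetaC d) ^ d := by simp

/-- the uniform bound `M(d, c, m²₊) = c⁻¹ C_R (48 ζ_d)^d` of the multiplier. [folklore] -/
def boundG (d : ℕ) (c m2plus : ℝ) : ℝ := c⁻¹ * CR d m2plus * (48 * zetaC d) ^ d

/-- the uniform bound is `≥ 0`. [folklore] -/
theorem boundG_nonneg (d : ℕ) {c m2plus : ℝ} (hc : 0 < c) (hm : 0 ≤ m2plus) : 0 ≤ boundG d c m2plus := by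
  unfold boundG
  have := CR_nonneg d hm
  have := zetaC_nonneg d
  positivity

/-- **THE UNIFORM BOUND OF THE MULTIPLIER ON THE FAT REGION** (StripLemma.md Lemma D, (S2)): where `|E(p′)| ≥ c > 0`,
`|G_{n,a,m²,τ}(p′)| ≤ c⁻¹ C_R(d, m²₊) (48 ζ_d)^d` — independent of `n = L^j`, of `τ`, of `a`, and of `m² ∈ [0, m²₊]`.
[folklore] -/
theorem norm_G_le (n : ℕ) [NeZero n] (hd : 0 < d) (a m2 m2plus : ℝ) (hm : 0 ≤ m2) (hmp : m2 ≤ m2plus)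
    {r : ℝ} (hr : r ≤ 1 / 4) (hdr : (d : ℝ) * r ^ 2 ≤ 1 / 16) {p : Fin d → ℂ} (hp : p ∈ Fat d r)
    {c : ℝ} (hc : 0 < c) (hE : c ≤ ‖E n a m2 p‖) (τ : Fin d → Fin n) :
    ‖G n a m2 τ p‖ ≤ boundG d c m2plus := by
  unfold G boundG
  have hCR := CR_nonneg d hm
  have hsum := sum_prod_le n hd (d := d)
  calc ‖∑ k : Fin d → Fin n, term n a m2 τ k p‖ ≤ ∑ k : Fin d → Fin n, ‖term n a m2 τ k p‖ := norm_sum_le _ _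
    _ ≤ ∑ k : Fin d → Fin n, c⁻¹ * CR d m2 * ∏ ν, 24 * omega n (k ν) ^ (-(1 + 2 / (d : ℝ))) :=
        Finset.sum_le_sum (fun k _ => norm_term_le n hd a m2 hm hr hdr hp hc hE τ k)
    _ = c⁻¹ * CR d m2 * ∑ k : Fin d → Fin n, ∏ ν, 24 * omega n (k ν) ^ (-(1 + 2 / (d : ℝ))) := by
        rw [Finset.mul_sum]
    _ ≤ c⁻¹ * CR d m2 * (48 * zetaC d) ^ d := mul_le_mul_of_nonneg_left hsum (by positivity)
    _ ≤ c⁻¹ * CR d m2plus * (48 * zetaC d) ^ d := by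
        have h1 := CR_mono d hmp
        have h2 : 0 ≤ (48 * zetaC d) ^ d := by have := zetaC_nonneg d; positivity
        have h3 : 0 ≤ c⁻¹ := by positivity
        nlinarith [mul_le_mul_of_nonneg_left h1 h3]


/-! ### §4 Joint holomorphy of the regrouped multiplier on the fat region -/

/-- `w` is entire. [folklore] -/
theorem differentiable_w (n j : ℕ) : Differentiable ℂ (w n j) := by
  unfold w; fun_prop

/-- `v` is entire (a trigonometric polynomial). [folklore] -/
theorem differentiable_v (n j : ℕ) : Differentiable ℂ (v n j) := by
  unfold v w; fun_prop

/-- the phase is entire. [folklore] -/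
theorem differentiable_ef (n j t : ℕ) : Differentiable ℂ (ef n j t) := by
  unfold ef; fun_prop

/-- `F_{n,τ}(k; ·)` is entire on `ℂ^d` (jointly). [folklore] -/
theorem differentiableAt_F (n : ℕ) (τ k : Fin d → Fin n) (q : Fin d → ℂ) :
    DifferentiableAt ℂ (F n τ k) q := by
  unfold F
  apply dAt_finset_prod
  intro ν _
  have h1 : DifferentiableAt ℂ (fun p : Fin d → ℂ => ef n (k ν) (τ ν) (p ν)) q :=
    DifferentiableAt.comp (g := ef n (k ν) (τ ν)) (f := fun p : Fin d → ℂ => p ν) q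
      ((differentiable_ef n (k ν) (τ ν)) (q ν)) (differentiableAt_apply (𝕜 := ℂ) ν q)
  have h2 : DifferentiableAt ℂ (fun p : Fin d → ℂ => v n (k ν) (p ν)) q :=
    DifferentiableAt.comp (g := v n (k ν)) (f := fun p : Fin d → ℂ => p ν) q
      ((differentiable_v n (k ν)) (q ν)) (differentiableAt_apply (𝕜 := ℂ) ν q)
  exact h1.mul h2

/-- `R_k` is holomorphic (jointly) at every point of the fat region. [folklore] -/
theorem differentiableAt_R (n : ℕ) [NeZero n] (m2 : ℝ) (hm : 0 ≤ m2) {r : ℝ} (hr : r ≤ 1 / 4)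
    (hdr : (d : ℝ) * r ^ 2 ≤ 1 / 16) {q : Fin d → ℂ} (hq : q ∈ Fat d r) (k : Fin d → Fin n) :
    DifferentiableAt ℂ (R n m2 k) q := by
  by_cases hk : k = fun _ => 0
  · have : R n m2 k = fun _ => (1 : ℂ) := by
      funext p; unfold R; rw [if_pos hk]
    rw [this]
    exact differentiableAt_const _
  · have : R n m2 k = fun p => DeltaXi n m2 p / DeltaXi n m2 (shift n k p) := by
      funext p; unfold R; rw [if_neg hk]
    rw [this]
    exact dAt_div (differentiableAt_DeltaXi n m2 q) (differentiableAt_DeltaXi_shift n m2 k q)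
      (DeltaXi_shift_ne_zero n m2 hm hr hdr hq k hk)

/-- one term is holomorphic (jointly) at every point of the fat region where `E ≠ 0`. [folklore] -/
theorem differentiableAt_term (n : ℕ) [NeZero n] (a m2 : ℝ) (hm : 0 ≤ m2) {r : ℝ} (hr : r ≤ 1 / 4)
    (hdr : (d : ℝ) * r ^ 2 ≤ 1 / 16) {q : Fin d → ℂ} (hq : q ∈ Fat d r) (hE : E n a m2 q ≠ 0)
    (τ k : Fin d → Fin n) : DifferentiableAt ℂ (term n a m2 τ k) q := by
  show DifferentiableAt ℂ (fun p => F n τ k p * R n m2 k p / E n a m2 p) q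
  exact dAt_div ((differentiableAt_F n τ k q).mul (differentiableAt_R n m2 hm hr hdr hq k))
    (differentiableAt_E n a m2 hm hr hdr hq) hE

/-- **THE REGROUPED MULTIPLIER IS HOLOMORPHIC (jointly) at every point of the fat region where `E ≠ 0`** — in
particular on the zero-free strip of `B4StripCauchy.uniformStrip_holds`. [folklore] -/
theorem differentiableAt_G (n : ℕ) [NeZero n] (a m2 : ℝ) (hm : 0 ≤ m2) {r : ℝ} (hr : r ≤ 1 / 4)
    (hdr : (d : ℝ) * r ^ 2 ≤ 1 / 16) {q : Fin d → ℂ} (hq : q ∈ Fat d r) (hE : E n a m2 q ≠ 0)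
    (τ : Fin d → Fin n) : DifferentiableAt ℂ (G n a m2 τ) q := by
  show DifferentiableAt ℂ (fun p => ∑ k : Fin d → Fin n, term n a m2 τ k p) q
  apply DifferentiableAt.fun_sum
  intro k _
  exact differentiableAt_term n a m2 hm hr hdr hq hE τ k

/-! ### §5 Periodicity across the sides of the strip -/

/-- `F_{n,τ}(k; p + 2π e_μ) = F_{n,τ}(σ_μ k; p)`: the numerator relabels under `2π`-shifts (on all of `ℂ^d`). [folklore] -/
theorem F_tr (n : ℕ) [NeZero n] (τ k : Fin d → Fin n) (p : Fin d → ℂ) (μ : Fin d) :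
    F n τ k (tr p μ) = F n τ (sigma n μ k) p := by
  unfold F
  refine Finset.prod_congr rfl (fun ν _ => ?_)
  by_cases h : ν = μ
  · subst h
    rw [tr_apply_self, sigma_apply_self, val_add_one_eq_mod, ef_add_two_pi _ _ _ (NeZero.ne n),
      v_add_two_pi _ _ (NeZero.ne n)]
  · rw [tr_apply_of_ne h, sigma_apply_of_ne n h]

/-- a translated left side point of the strip is the right side point, again in the strip. [folklore] -/
theorem tr_mem_Strip {κ : ℝ} {p : Fin d → ℂ} (hp : p ∈ Strip d κ) (μ : Fin d) (hre : (p μ).re = -Real.pi) :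
    tr p μ ∈ Strip d κ := by
  intro ν
  refine ⟨?_, by rw [tr_im]; exact (hp ν).2⟩
  by_cases h : ν = μ
  · subst h
    rw [tr_re_self, hre]
    ring_nf
    rw [abs_of_pos Real.pi_pos]
  · rw [tr_apply_of_ne h]; exact (hp ν).1

/-- **SIDE PERIODICITY OF ONE TERM**: at a strip point with `Re p_μ = −π` (where `Δ^ξ+m²` does not vanish at `p` and at
`p + 2π e_μ`, `B5Strip145Analytic.re_DeltaXi_pos_of_edge`) and `E ≠ 0` at both points,
`term_k(p + 2π e_μ) = term_{σ_μ k}(p)` — by the shift law `B5Strip145Analytic.E_tr` of `E`. [folklore] -/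
theorem term_tr_side (n : ℕ) [NeZero n] (a m2 : ℝ) (hm : 0 ≤ m2) {κ : ℝ} (hκ1 : κ ≤ 1)
    (hdκ : (d : ℝ) * κ ^ 2 ≤ 1 / 16) {p : Fin d → ℂ} (hp : p ∈ Strip d κ) (μ : Fin d)
    (hre : (p μ).re = -Real.pi) (hE0 : E n a m2 p ≠ 0) (hE1 : E n a m2 (tr p μ) ≠ 0)
    (τ k : Fin d → Fin n) : term n a m2 τ k (tr p μ) = term n a m2 τ (sigma n μ k) p := by
  have hπ := Real.pi_pos
  have hz : p μ ≠ 0 := by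
    intro h; rw [h, Complex.zero_re] at hre; linarith
  have hz' : p μ + 2 * Real.pi ≠ 0 := by
    intro h
    have := congrArg Complex.re h
    rw [← tr_apply_self, tr_re_self, hre, Complex.zero_re] at this
    linarith
  have h0 : DeltaXi n m2 p ≠ 0 := by
    intro h
    have := re_DeltaXi_pos_of_edge n m2 hm hκ1 hdκ (fun ν => (hp ν).2) μ
      (by rw [hre, abs_neg, abs_of_pos hπ])
    rw [h, Complex.zero_re] at this
    linarith
  have h1 : DeltaXi n m2 (tr p μ) ≠ 0 := by
    intro h
    have := re_DeltaXi_pos_of_edge n m2 hm hκ1 hdκ (q := tr p μ)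
      (fun ν => by rw [tr_im]; exact (hp ν).2) μ (by rw [tr_re_self, hre]; ring_nf; exact abs_of_pos hπ)
    rw [h, Complex.zero_re] at this
    linarith
  have hEtr := E_tr n a m2 p μ hz hz' h0 h1
  unfold term
  rw [F_tr, R_eq_div n m2 k (tr p μ) h1, R_eq_div n m2 (sigma n μ k) p h0, DeltaXi_shift_tr n m2 k p μ]
  by_cases hDS : DeltaXi n m2 (shift n (sigma n μ k) p) = 0
  · simp [hDS]
  · rw [div_eq_div_iff hE1 hE0]
    field_simp
    linear_combination (-(F n τ (sigma n μ k) p)) * hEtr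

/-- **SIDE PERIODICITY OF THE MULTIPLIER**: `G(p + 2π e_μ) = G(p)` at the strip points with `Re p_μ = −π` (relabel the
`l`-sum by `σ_μ`). [folklore] -/
theorem G_tr_side (n : ℕ) [NeZero n] (a m2 : ℝ) (hm : 0 ≤ m2) {κ : ℝ} (hκ1 : κ ≤ 1)
    (hdκ : (d : ℝ) * κ ^ 2 ≤ 1 / 16) {p : Fin d → ℂ} (hp : p ∈ Strip d κ) (μ : Fin d)
    (hre : (p μ).re = -Real.pi) (hE0 : E n a m2 p ≠ 0) (hE1 : E n a m2 (tr p μ) ≠ 0)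
    (τ : Fin d → Fin n) : G n a m2 τ (tr p μ) = G n a m2 τ p := by
  unfold G
  calc ∑ k : Fin d → Fin n, term n a m2 τ k (tr p μ) = ∑ k : Fin d → Fin n, term n a m2 τ (sigma n μ k) p :=
        Finset.sum_congr rfl (fun k _ => term_tr_side n a m2 hm hκ1 hdκ hp μ hre hE0 hE1 τ k)
    _ = ∑ k : Fin d → Fin n, term n a m2 τ k p :=
        Equiv.sum_comp (sigmaEquiv n μ) (fun k => term n a m2 τ k p)

/-! ### §6 Assembly: strip regularity of the multiplier and the exponential decay of the kernel of `G_j Q_j^*` -/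

/-- **STRIP REGULARITY OF THE MULTIPLIER OF `G_j Q_j^*`** in the sense of `B4ContourShift.StripRegular`: on a strip
`Strip (d+1) κ`, `0 ≤ κ ≤ r = 1/(4(d+2))`, on which `|E| ≥ c > 0`, the regrouped multiplier `G_{n,a,m²,τ}` is continuous,
holomorphic in each coordinate, periodic across the sides, and bounded by `boundG (d+1) c m²₊` — for EVERY `n ≥ 1`, `a`,
`m² ∈ [0, m²₊]` and every block offset `τ`. [folklore] -/
theorem stripRegular_G (n : ℕ) [NeZero n] (a m2 m2plus : ℝ) (hm : 0 ≤ m2) (hmp : m2 ≤ m2plus)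
    (τ : Fin (d + 1) → Fin n) {κ c : ℝ} (hκ0 : 0 ≤ κ) (hκr : κ ≤ rOf (d + 1)) (hc : 0 < c)
    (hE : ∀ p ∈ Strip (d + 1) κ, c ≤ ‖E n a m2 p‖) :
    StripRegular (d := d) (G n a m2 τ) κ (boundG (d + 1) c m2plus) := by
  obtain ⟨hκ1, hdκ⟩ := kappa_small hκ0 hκr
  have hfat : Strip (d + 1) κ ⊆ Fat (d + 1) (rOf (d + 1)) := strip_subset_fat (rOf_pos _).le hκr
  have hd : 0 < d + 1 := Nat.succ_pos d
  have hne : ∀ p ∈ Strip (d + 1) κ, E n a m2 p ≠ 0 := by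
    intro p hp h
    have := hE p hp
    rw [h, norm_zero] at this
    linarith
  have hdiffAt : ∀ p ∈ Strip (d + 1) κ, DifferentiableAt ℂ (G n a m2 τ) p := fun p hp =>
    differentiableAt_G n a m2 hm (rOf_le _) (d_mul_rOf_sq_le _) (hfat hp) (hne p hp) τ
  refine ⟨?_, ?_, ?_, ?_⟩
  · exact fun p hp => (hdiffAt p hp).continuousAt.continuousWithinAt
  · intro i q hq z hz
    have hP : i.insertNth z (ofRealVec q) ∈ Strip (d + 1) κ :=
      insertNth_mem_Strip hκ0 i hq (openRect_subset_closedRect κ hz)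
    exact ((hdiffAt _ hP).comp z (differentiableAt_insertNth i _ z)).differentiableWithinAt
  · intro i q hq y hy
    obtain ⟨hP, hre⟩ := insertNth_left_mem hκ0 i hq hy
    rw [← tr_insertNth_left]
    have hP' := tr_mem_Strip hP i hre
    exact (G_tr_side n a m2 hm hκ1 hdκ hP i hre (hne _ hP) (hne _ hP') τ).symm
  · intro p hp
    exact norm_G_le n hd a m2 m2plus hm hmp (rOf_le _) (d_mul_rOf_sq_le _) (hfat hp) hc (hE p hp) τ

/-- **B4 LEMMA 2.4 FOR `G_j Q_j^*`, MULTIPLIER FORM (the uniform zero-free strip + the `n`-uniform sums of (2.48)–(2.51)).**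
For `0 < a₋ ≤ a₊` and `m²₊` there are `κ > 0` and `M ≥ 0` such that for EVERY `n = L^j ≥ 1`, `a ∈ [a₋, a₊]`,
`m² ∈ [0, m²₊]` and every block offset `τ ∈ {0,…,n−1}^{d+1}` the multiplier `G_{n,a,m²,τ}` of `G_j Q_j^*` is
`StripRegular` on `Strip (d+1) κ` with bound `M`.  ONLY HYPOTHESIS: `0 < a₋`. [cite: Balaban1983RegularityDecay,
Lemma 2.4 (2.35) p.582 with (2.48)–(2.51) pp.585–586; proof supplied by the audit along the printed method] -/
theorem multiplier248_stripRegular (d : ℕ) (aminus aplus m2plus : ℝ) (ha : 0 < aminus) :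
    ∃ κ M : ℝ, 0 < κ ∧ 0 ≤ M ∧ ∀ (n : ℕ) [NeZero n] (a m2 : ℝ), aminus ≤ a → a ≤ aplus → 0 ≤ m2 →
      m2 ≤ m2plus → ∀ τ : Fin (d + 1) → Fin n, StripRegular (d := d) (G n a m2 τ) κ M := by
  obtain ⟨κ₁, c, hκ₁, hc, h⟩ := uniformStrip_holds (d + 1) aminus aplus m2plus ha
  refine ⟨min κ₁ (rOf (d + 1)), boundG (d + 1) c (max m2plus 0), lt_min hκ₁ (rOf_pos _),
    boundG_nonneg _ hc (le_max_right _ _), ?_⟩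
  intro n _ a m2 ha1 ha2 hm hmp τ
  have hκ0 : 0 ≤ min κ₁ (rOf (d + 1)) := (lt_min hκ₁ (rOf_pos _)).le
  have hsub : Strip (d + 1) (min κ₁ (rOf (d + 1))) ⊆ Strip (d + 1) κ₁ := strip_mono (min_le_left _ _)
  exact stripRegular_G n a m2 (max m2plus 0) hm (hmp.trans (le_max_left _ _)) τ hκ0 (min_le_right _ _) hc
    (fun p hp => h n a m2 ha1 ha2 hm hmp p (hsub hp))

/-- **B4 LEMMA 2.4 (2.35) FOR `G_j Q_j^*` — THE `j`-UNIFORM EXPONENTIAL DECAY OF THE KERNEL (infinite-volume torus).**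
For `0 < a₋ ≤ a₊` and `m²₊` there are `κ > 0`, `M ≥ 0` such that for EVERY `n = L^j ≥ 1`, `a ∈ [a₋, a₊]`, `m² ∈ [0, m²₊]`,
every block offset `τ` and every `x ∈ ℤ^{d+1}`:
`|(2π)^{-(d+1)} ∫_{[-π,π]^{d+1}} G_{n,a,m²,τ}(p′) e^{ip′·x} dp′| ≤ M e^{−κ |x|_∞}`,
i.e. `|(G_jQ_j^*)(y + τ/n, y′)| ≤ M e^{−κ|y − y′|_∞}` for `y, y′ ∈ ℤ^{d+1}` (distance in `L^j ξ`-units `= 1`; `|x−x′|` and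
`|y−y′|` differ by at most `1`).  Assembled from `multiplier248_stripRegular` and the generic engine
`B4ContourShift.latticeKernel_decay`.  Not covered here: the derivative factors `∂^ξ_μ` of (2.35)–(2.36) (multiplier
`n(e^{i(p′_μ+l_μ)/n} − 1)`, growing in `l`; the Hölder bound (2.36)), the finite-torus kernel (Poisson periodisation), and
the operators with boundary conditions `G_k(Ω, Λ, A)` of §2 (Cor. 2.3, GAPS G-B4-04).
[cite: Balaban1983RegularityDecay, Lemma 2.4 (2.35) p.582 with (2.48)–(2.51) pp.585–586; proof supplied by the audit along the printed method] -/
theorem kernel248_decay (d : ℕ) (aminus aplus m2plus : ℝ) (ha : 0 < aminus) :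
    ∃ κ M : ℝ, 0 < κ ∧ 0 ≤ M ∧ ∀ (n : ℕ) [NeZero n] (a m2 : ℝ), aminus ≤ a → a ≤ aplus → 0 ≤ m2 →
      m2 ≤ m2plus → ∀ (τ : Fin (d + 1) → Fin n) (x : Fin (d + 1) → ℤ),
        ‖latticeKernel (G n a m2 τ) x‖ ≤ M * Real.exp (-(κ * supNorm x)) := by
  obtain ⟨κ, M, hκ, hM, h⟩ := multiplier248_stripRegular d aminus aplus m2plus ha
  refine ⟨κ, M, hκ, hM, ?_⟩
  intro n _ a m2 ha1 ha2 hm hmp τ x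
  exact latticeKernel_decay (h n a m2 ha1 ha2 hm hmp τ) hκ.le x

/-- Euclidean form of the decay: rate `κ/√(d+1)` in `|x|_2`. [cite: Balaban1983RegularityDecay, Lemma 2.4 (2.35) p.582;
proof supplied by the audit along the printed method] -/
theorem kernel248_decay_euclid (d : ℕ) (aminus aplus m2plus : ℝ) (ha : 0 < aminus) :
    ∃ κ M : ℝ, 0 < κ ∧ 0 ≤ M ∧ ∀ (n : ℕ) [NeZero n] (a m2 : ℝ), aminus ≤ a → a ≤ aplus → 0 ≤ m2 →
      m2 ≤ m2plus → ∀ (τ : Fin (d + 1) → Fin n) (x : Fin (d + 1) → ℤ),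
        ‖latticeKernel (G n a m2 τ) x‖
          ≤ M * Real.exp (-(κ / Real.sqrt (d + 1) * Real.sqrt (∑ i, ((x i : ℝ)) ^ 2))) := by
  obtain ⟨κ, M, hκ, hM, h⟩ := multiplier248_stripRegular d aminus aplus m2plus ha
  refine ⟨κ, M, hκ, hM, ?_⟩
  intro n _ a m2 ha1 ha2 hm hmp τ x
  exact latticeKernel_decay_euclid (h n a m2 ha1 ha2 hm hmp τ) hκ.le hM x

end

end Literature.MathematicalPhysics.QuantumFieldTheory.Balaban1983to89.B4StripSums
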